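import Summits.HubbardSuperconductivity.HubbardSuperconductivity.Theorems.TwSourcedCondensation.Negative.SourceResponseStructure
import Literature.MathematicalPhysics.QuantumLattice.LiebFluxPhaseProofs
import Literature.MathematicalPhysics.QuantumLattice.ApproximateEigenvectorLemmas

/-!
# Crux `TwSourcedCondensation` (item `stmt-HubbardSuperconductivity-1697`): finite-volume upper
bounds on the sourced response — support lemmas from the standing disprover (generation 2)

The crux asks, eventually in `L`, for the LOWER bound `c h² log(1/(|h|+1/β)) - C h²` on the response
`p̃_L(h) - p̃_L(0)` of the torus pressure to the `d`-wave pair source. This file proves what a FIXED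
finite volume can and cannot deliver, for all `L ≥ 1`, `U, μ`:

* `re_duhamel_self_le` — the Duhamel two-point function is bounded by the norm,
  `(A,A)_{β,H} ≤ 2‖A‖²` (pair-sum form; logarithmic mean ≤ sum of the Boltzmann weights;
  `⟨A²⟩ ≤ ‖A‖²`);
* `re_gibbsState_source_le` — a centred source magnetisation grows at most linearly,
  `Re⟨A⟩_{β,H-tA} ≤ 2β‖A‖²t` (`t > 0`), by the mean value theorem for the susceptibility formula
  `m' = β((A,A) - m²)` of the tree;
* `log_partitionFn_sub_le_quadratic` / `pressure_response_le_quadratic` — the QUADRATIC bound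
  `p̃_L(h) - p̃_L(0) ≤ 256 β L² h²` for the `d`-wave source (Bogoliubov's inequality at `H_{L,h}`):
  the finite-volume response is `O(h²)` with a `β`- and `L`-dependent constant — so the `1/β`
  inside the crux's logarithm and the order `h²` cannot be improved at fixed volume;
* `rayleigh_source_ge_of_gap`, `groundEnergy_source_ge_of_gap`,
  `log_partitionFn_source_sub_le_of_gap` — for a Hamiltonian with a UNIQUE GAPPED ground vector
  `ψ₀` (`H ≥ E₀ + γ(1 - |ψ₀⟩⟨ψ₀|)`) and `⟨ψ₀,Qψ₀⟩ = 0`: `E₀(H - hQ) ≥ E₀ - h²‖Q‖²/γ` and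
  `log Z_β(H - hQ) - log Z_β(H) ≤ βh²‖Q‖²/γ + log dim`, UNIFORMLY in `β` — a gapped cluster never
  carries a `log β`; this is the finite-size mechanism that makes the crux's `∃ L₀ = L₀(U,β,μ)`
  load-bearing (the workfile `Cruxes/TwSourcedCondensation/Disproof.lean` §7a turns it into the
  refutation of any frozen threshold, granted an explicit cluster spectral hypothesis).

Sources: F. J. Dyson, E. H. Lieb, B. Simon, J. Stat. Phys. 18 (1978) 335, §3 and eq. (35) (Duhamel
two-point function, pair-sum form) [DLS1978]; Bratteli–Robinson II §5.3 (Bogoliubov/Peierls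
convexity); H. Tasaki, *Physics and Mathematics of Quantum Many-Body Systems* (2020) §2.1
(variational principle) [Tasaki2020]. Tree: `IsHermitian.re_duhamel_self`, `re_gibbsState_sq`
(`DuhamelTwoPoint`), `hasDerivAt_re_gibbsState_source`, `isHermitian_sub_smul`
(`ApproximatingHamiltonianProofs`), `exp_neg_mul_groundEnergy_le_partitionFn`,
`partitionFn_le_card_mul_exp` (`LiebFluxPhaseProofs`), `eucNorm` API (`ApproximateEigenvectorLemmas`),
`minEnergyOn_top_holds` (`FinDimSpectrumProofs`), and the sibling file `SourceResponseStructure`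
(`gibbsState_hubbardTorusWith_pairSource`, `partitionFn_dWaveSourceTorus_neg`).
-/

noncomputable section

namespace Summit.HubbardSuperconductivity.HubbardSuperconductivity.Theorems.TwSourcedCondensation.Negative

open Matrix Finset Literature.MathematicalPhysics.QuantumLattice Literature.Probability.LatticeModels
open scoped Matrix.Norms.L2Operator ComplexOrder ComplexConjugate
open intervalIntegral

/-! ### The Duhamel function is bounded by the norm; magnetisation grows at most linearly -/

section Duhamel

/-- The Duhamel kernel (logarithmic mean of two Boltzmann weights) is at most their sum. [cite: DLS1978, eq. (35)] -/
theorem duhamelKernel_le_add (β x y : ℝ) :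
    duhamelKernel β x y ≤ Real.exp (-(β * x)) + Real.exp (-(β * y)) := by
  have hconst : ∫ _ in (0 : ℝ)..1, (Real.exp (-(β * x)) + Real.exp (-(β * y))) =
      Real.exp (-(β * x)) + Real.exp (-(β * y)) := by simp
  rw [duhamelKernel, ← hconst]
  refine intervalIntegral.integral_mono_on zero_le_one
    ((continuous_duhamelKernel_integrand β x y).intervalIntegrable _ _) (by simp) fun s hs => ?_
  obtain ⟨hs0, hs1⟩ := hs
  have key : -(β * (s * y + (1 - s) * x)) = s * (-(β * y)) + (1 - s) * (-(β * x)) := by ring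
  rw [key]
  rcases le_total (-(β * x)) (-(β * y)) with hxy | hxy
  · calc Real.exp (s * -(β * y) + (1 - s) * -(β * x)) ≤ Real.exp (-(β * y)) :=
          Real.exp_le_exp.2 (by nlinarith)
      _ ≤ _ := le_add_of_nonneg_left (Real.exp_pos _).le
  · calc Real.exp (s * -(β * y) + (1 - s) * -(β * x)) ≤ Real.exp (-(β * x)) :=
          Real.exp_le_exp.2 (by nlinarith)
      _ ≤ _ := le_add_of_nonneg_right (Real.exp_pos _).le

variable {m : Type*} [Fintype m] [DecidableEq m]

/-- **`(A, A)_{β,H} ≤ 2‖A‖²`** for Hermitian `H`, `A`. [cite: DLS1978, §3] -/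
theorem re_duhamel_self_le {H A : Matrix m m ℂ} (hH : H.IsHermitian) (hA : A.IsHermitian)
    [Nonempty m] (β : ℝ) : (duhamel β H A A).re ≤ 2 * ‖A‖ ^ 2 := by
  rw [hH.re_duhamel_self hA β]
  set V := (hH.eigenvectorUnitary : Matrix m m ℂ) with hV
  set E := hH.eigenvalues with hE
  set a := star V * A * V with ha
  set w : m → ℝ := fun i => Real.exp (-(β * E i)) with hw
  have hZ : 0 < ∑ i, w i := sum_pos (fun i _ => Real.exp_pos _) univ_nonempty
  have hsymm : ∀ i j, ‖a i j‖ = ‖a j i‖ := by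
    intro i j
    have haH : aᴴ = a := by
      rw [ha, conjTranspose_mul, conjTranspose_mul, hA.eq, star_eq_conjTranspose,
        conjTranspose_conjTranspose, Matrix.mul_assoc]
    have hij : aᴴ i j = a i j := by rw [haH]
    rw [conjTranspose_apply] at hij
    rw [← hij, norm_star]
  have hsq : (gibbsState β H (A * A)).re = (∑ i, w i)⁻¹ * ∑ i, ∑ j, ‖a i j‖ ^ 2 * w i :=
    hH.re_gibbsState_sq hA β
  have hbound : (gibbsState β H (A * A)).re ≤ ‖A‖ ^ 2 := by
    calc (gibbsState β H (A * A)).re ≤ |(gibbsState β H (A * A)).re| := le_abs_self _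
      _ ≤ ‖A * A‖ := abs_re_gibbsState_le hH β _
      _ ≤ ‖A‖ * ‖A‖ := norm_mul_le _ _
      _ = ‖A‖ ^ 2 := (sq _).symm
  have hswap : ∑ i, ∑ j, ‖a i j‖ ^ 2 * w j = ∑ i, ∑ j, ‖a i j‖ ^ 2 * w i := by
    rw [Finset.sum_comm]
    refine sum_congr rfl fun i _ => sum_congr rfl fun j _ => ?_
    rw [hsymm j i]
  calc (∑ i, w i)⁻¹ * ∑ i, ∑ j, ‖a i j‖ ^ 2 * duhamelKernel β (E i) (E j)
      ≤ (∑ i, w i)⁻¹ * ∑ i, ∑ j, ‖a i j‖ ^ 2 * (w i + w j) := by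
        refine mul_le_mul_of_nonneg_left (sum_le_sum fun i _ => sum_le_sum fun j _ =>
          mul_le_mul_of_nonneg_left (duhamelKernel_le_add β _ _) (sq_nonneg _)) (inv_nonneg.2 hZ.le)
    _ = 2 * (gibbsState β H (A * A)).re := by
        rw [hsq]
        simp only [mul_add, Finset.sum_add_distrib]
        rw [hswap]
        ring
    _ ≤ 2 * ‖A‖ ^ 2 := by linarith

/-- **Centred source magnetisations grow at most linearly**: if `⟨A⟩_{β,H} = 0` then
`Re⟨A⟩_{β, H - tA} ≤ 2β‖A‖² t` for `t > 0` (`m' = β((A,A) - m²) ≤ 2β‖A‖²`, mean value theorem). [cite: DLS1978, §3] -/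
theorem re_gibbsState_source_le {H A : Matrix m m ℂ} (hH : H.IsHermitian) (hA : A.IsHermitian)
    [Nonempty m] {β : ℝ} (hβ : 0 < β) (h0 : (gibbsState β H A).re = 0) {t : ℝ} (ht : 0 < t) :
    (gibbsState β (H - (t : ℂ) • A) A).re ≤ 2 * β * ‖A‖ ^ 2 * t := by
  set f : ℝ → ℝ := fun s => (gibbsState β (H - (s : ℂ) • A) A).re with hf
  set f' : ℝ → ℝ := fun s => β * ((duhamel β (H - (s : ℂ) • A) A A).re -
    (gibbsState β (H - (s : ℂ) • A) A).re ^ 2) with hf'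
  have hd : ∀ s, HasDerivAt f (f' s) s := fun s => hasDerivAt_re_gibbsState_source hH hA hβ s
  obtain ⟨ξ, -, hslope⟩ := exists_hasDerivAt_eq_slope f f' ht
    (fun s _ => (hd s).continuousAt.continuousWithinAt) (fun s _ => hd s)
  have hf0 : f 0 = 0 := by simp [hf, h0]
  have hbound : f' ξ ≤ 2 * β * ‖A‖ ^ 2 := by
    have h1 := re_duhamel_self_le (isHermitian_sub_smul hH hA ξ) hA β
    have h2 : 0 ≤ (gibbsState β (H - (ξ : ℂ) • A) A).re ^ 2 := sq_nonneg _
    have h3 : f' ξ = β * ((duhamel β (H - (ξ : ℂ) • A) A A).re -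
      (gibbsState β (H - (ξ : ℂ) • A) A).re ^ 2) := rfl
    rw [h3]
    nlinarith
  have hft : f t = f' ξ * t := by
    rw [hslope, hf0, sub_zero, sub_zero, div_mul_cancel₀ _ ht.ne']
  calc (gibbsState β (H - (t : ℂ) • A) A).re = f t := rfl
    _ = f' ξ * t := hft
    _ ≤ 2 * β * ‖A‖ ^ 2 * t := mul_le_mul_of_nonneg_right hbound ht.le

end Duhamel

/-! ### The quadratic bound for the `d`-wave source on the torus -/

section Torus

variable (L : ℕ) [NeZero L]

/-- **Quadratic upper bound, numerator form** (`β > 0`, `h > 0`):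
`log Z_β(H_{L,h}) - log Z_β(H_{L,0}) ≤ 2β²‖Δ_d+Δ_d†‖²h² ≤ 2β²(8√2L²)²h²`. [folklore] -/
theorem log_partitionFn_sub_le_quadratic {β : ℝ} (hβ : 0 < β) (U μ : ℝ) {h : ℝ} (hh : 0 < h) :
    Real.log (partitionFn β (dWaveSourceTorus L U μ h)).re -
        Real.log (partitionFn β (dWaveSourceTorus L U μ 0)).re ≤
      2 * β ^ 2 * (8 * Real.sqrt 2 * (L : ℝ) ^ 2) ^ 2 * h ^ 2 := by
  set Q := pairField dWaveFormFactor L + (pairField dWaveFormFactor L)ᴴ with hQdef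
  have hK := isHermitian_hubbardTorusWith L 1 U μ
  have hQ : Q.IsHermitian := isHermitian_pairField_add_conjTranspose L
  have hKh : (hubbardTorusWith 2 L 1 U μ - (h : ℂ) • Q).IsHermitian := isHermitian_sub_smul hK hQ h
  have hW : ((h : ℂ) • Q).IsHermitian := isHermitian_real_smul hQ h
  have hmag := re_gibbsState_source_le hK hQ hβ
    (by rw [hQdef, gibbsState_hubbardTorusWith_pairSource, Complex.zero_re]) hh
  have hPB := log_partitionFn_sub_le_log_partitionFn_add hKh hW β
  rw [sub_add_cancel, map_smul, smul_eq_mul, Complex.re_ofReal_mul] at hPB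
  have hnorm : ‖Q‖ ≤ 8 * Real.sqrt 2 * (L : ℝ) ^ 2 := norm_dWavePairSource_le L
  have hsq : ‖Q‖ ^ 2 ≤ (8 * Real.sqrt 2 * (L : ℝ) ^ 2) ^ 2 := pow_le_pow_left₀ (norm_nonneg _) hnorm 2
  have hK0 : dWaveSourceTorus L U μ 0 = hubbardTorusWith 2 L 1 U μ := dWaveSourceTorus_zero L U μ
  have hKh' : dWaveSourceTorus L U μ h = hubbardTorusWith 2 L 1 U μ - (h : ℂ) • Q := rfl
  rw [hK0, hKh']
  have step : β * (h * (gibbsState β (hubbardTorusWith 2 L 1 U μ - (h : ℂ) • Q) Q).re) ≤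
      β * (h * (2 * β * ‖Q‖ ^ 2 * h)) :=
    mul_le_mul_of_nonneg_left (mul_le_mul_of_nonneg_left hmag hh.le) hβ.le
  have step2 : β * (h * (2 * β * ‖Q‖ ^ 2 * h)) ≤ 2 * β ^ 2 * (8 * Real.sqrt 2 * (L : ℝ) ^ 2) ^ 2 * h ^ 2 := by
    have : 0 ≤ β ^ 2 * h ^ 2 := by positivity
    nlinarith
  linarith

/-- **Quadratic upper bound for the response**: `p̃_L(h) - p̃_L(0) ≤ 256 β L² h²` for `β > 0`, every
`L ≥ 1`, all `U, μ` and ALL real `h` (evenness for `h < 0`). The constant grows with `β` and `L`,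
as the physical susceptibility `χ_L(β)` does. [folklore] -/
theorem pressure_response_le_quadratic {β : ℝ} (hβ : 0 < β) (U μ h : ℝ) :
    Real.log (partitionFn β (dWaveSourceTorus L U μ h)).re / (β * (L : ℝ) ^ 2) -
        Real.log (partitionFn β (dWaveSourceTorus L U μ 0)).re / (β * (L : ℝ) ^ 2) ≤
      256 * β * (L : ℝ) ^ 2 * h ^ 2 := by
  have hL : (0 : ℝ) < (L : ℝ) ^ 2 := cast_sq_pos_of_neZero L
  have hden : 0 < β * (L : ℝ) ^ 2 := mul_pos hβ hL
  have h2 : Real.sqrt 2 ^ 2 = 2 := Real.sq_sqrt zero_le_two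
  have pos_case : ∀ {k : ℝ}, 0 < k →
      Real.log (partitionFn β (dWaveSourceTorus L U μ k)).re / (β * (L : ℝ) ^ 2) -
        Real.log (partitionFn β (dWaveSourceTorus L U μ 0)).re / (β * (L : ℝ) ^ 2) ≤
      256 * β * (L : ℝ) ^ 2 * k ^ 2 := by
    intro k hk
    rw [← sub_div, div_le_iff₀ hden]
    calc Real.log (partitionFn β (dWaveSourceTorus L U μ k)).re -
          Real.log (partitionFn β (dWaveSourceTorus L U μ 0)).re
        ≤ 2 * β ^ 2 * (8 * Real.sqrt 2 * (L : ℝ) ^ 2) ^ 2 * k ^ 2 := log_partitionFn_sub_le_quadratic L hβ U μ hk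
      _ = 256 * β * (L : ℝ) ^ 2 * k ^ 2 * (β * (L : ℝ) ^ 2) := by rw [mul_pow, mul_pow, h2]; ring
  rcases lt_trichotomy h 0 with hneg | rfl | hpos
  · have := pos_case (neg_pos.2 hneg)
    rwa [partitionFn_dWaveSourceTorus_neg, neg_sq] at this
  · simp
  · exact pos_case hpos

end Torus

/-! ### Gapped clusters: a `β`-uniform cap on the response -/

section Gapped

variable {m : Type*} [Fintype m] [DecidableEq m]

/-- A unit coordinate vector (nonemptiness of Rayleigh sets). [folklore] -/
theorem star_single_dotProduct_single (i : m) :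
    star (Pi.single i (1 : ℂ)) ⬝ᵥ Pi.single i (1 : ℂ) = 1 := by
  simp [dotProduct, Pi.single_apply]

/-- `c ≤ E₀(A)` as soon as `c ≤ Re⟨φ, Aφ⟩` for every unit vector. [cite: Tasaki2020, §2.1] -/
theorem le_groundEnergy_of_forall_rayleigh {A : Matrix m m ℂ} (hA : A.IsHermitian) [Nonempty m]
    {c : ℝ} (hc : ∀ φ : m → ℂ, star φ ⬝ᵥ φ = 1 → c ≤ (star φ ⬝ᵥ A *ᵥ φ).re) :
    c ≤ A.groundEnergy := by
  rw [← minEnergyOn_top_holds hA]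
  obtain ⟨i⟩ := ‹Nonempty m›
  refine le_csInf ⟨_, Pi.single i 1, Submodule.mem_top, star_single_dotProduct_single i, rfl⟩ ?_
  rintro E ⟨φ, -, hφ1, rfl⟩
  exact hc φ hφ1

/-- **Second-order variational bound at a gapped non-degenerate ground state**: if
`Re⟨φ,Hφ⟩ ≥ E₀ + γ(1 - |⟨ψ₀,φ⟩|²)` for all unit `φ` (`γ > 0`, `ψ₀` unit) and `⟨ψ₀,Qψ₀⟩ = 0`, then
`Re⟨φ,(H - hQ)φ⟩ ≥ E₀ - h²‖Q‖²/γ` for every unit `φ` and real `h` (`φ = αψ₀ + χ`,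
`|⟨φ,Qφ⟩| ≤ 2‖Q‖‖χ‖`, `γ‖χ‖² - 2|h|‖Q‖‖χ‖ ≥ -h²‖Q‖²/γ`). [cite: Tasaki2020, §2.1] -/
theorem rayleigh_source_ge_of_gap {H Q : Matrix m m ℂ} {ψ₀ : m → ℂ} (hψ₀ : star ψ₀ ⬝ᵥ ψ₀ = 1)
    {E₀ γ : ℝ} (hγ : 0 < γ)
    (hgap : ∀ φ : m → ℂ, star φ ⬝ᵥ φ = 1 →
      E₀ + γ * (1 - ‖star ψ₀ ⬝ᵥ φ‖ ^ 2) ≤ (star φ ⬝ᵥ H *ᵥ φ).re)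
    (h1 : star ψ₀ ⬝ᵥ Q *ᵥ ψ₀ = 0) (h : ℝ) (φ : m → ℂ) (hφ : star φ ⬝ᵥ φ = 1) :
    E₀ - h ^ 2 * ‖Q‖ ^ 2 / γ ≤ (star φ ⬝ᵥ (H - (h : ℂ) • Q) *ᵥ φ).re := by
  set α : ℂ := star ψ₀ ⬝ᵥ φ with hα
  set χ : m → ℂ := φ - α • ψ₀ with hχ
  have hφ1 : eucNorm φ = 1 := eucNorm_eq_one hφ
  have hψ1 : eucNorm ψ₀ = 1 := eucNorm_eq_one hψ₀
  have hdecomp : φ = χ + α • ψ₀ := by rw [hχ, sub_add_cancel]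
  have hχsq : eucNorm χ ^ 2 = 1 - ‖α‖ ^ 2 := by
    have hstarχ : star χ = star φ - star α • star ψ₀ := by
      rw [hχ, star_sub, star_smul]
    have e1 : star χ ⬝ᵥ χ = star φ ⬝ᵥ φ - star α * (star ψ₀ ⬝ᵥ φ) - α * (star φ ⬝ᵥ ψ₀) +
        star α * α * (star ψ₀ ⬝ᵥ ψ₀) := by
      rw [hstarχ, hχ, sub_dotProduct, dotProduct_sub, dotProduct_sub, smul_dotProduct, smul_dotProduct,
        dotProduct_smul, dotProduct_smul]
      simp only [smul_eq_mul]
      ring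
    have e2 : star φ ⬝ᵥ ψ₀ = star α := by
      rw [hα, ← star_dotProduct_star, star_star]
    rw [eucNorm_sq, e1, hφ, hψ₀, ← hα, e2]
    have : star α * α = ((‖α‖ ^ 2 : ℝ) : ℂ) := by
      rw [Complex.star_def, mul_comm, Complex.mul_conj, Complex.normSq_eq_norm_sq]
    rw [mul_one, this]
    simp only [Complex.sub_re, Complex.add_re, Complex.one_re, Complex.ofReal_re]
    have hre' : (α * star α).re = ‖α‖ ^ 2 := by
      rw [mul_comm, this, Complex.ofReal_re]
    rw [hre']
    ring
  have hQφ : ‖star φ ⬝ᵥ Q *ᵥ φ‖ ≤ 2 * ‖Q‖ * eucNorm χ := by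
    have hsplit : star φ ⬝ᵥ Q *ᵥ φ = star χ ⬝ᵥ Q *ᵥ φ + star α * (star ψ₀ ⬝ᵥ Q *ᵥ χ) := by
      have e : star φ = star χ + star α • star ψ₀ := by
        rw [hdecomp, star_add, star_smul]
      have e3 : star ψ₀ ⬝ᵥ Q *ᵥ φ = star ψ₀ ⬝ᵥ Q *ᵥ χ := by
        rw [hdecomp, mulVec_add, mulVec_smul, dotProduct_add, dotProduct_smul, h1, smul_zero, add_zero]
      calc star φ ⬝ᵥ Q *ᵥ φ = (star χ + star α • star ψ₀) ⬝ᵥ Q *ᵥ φ := by rw [e]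
        _ = star χ ⬝ᵥ Q *ᵥ φ + star α * (star ψ₀ ⬝ᵥ Q *ᵥ φ) := by
            rw [add_dotProduct, smul_dotProduct, smul_eq_mul]
        _ = star χ ⬝ᵥ Q *ᵥ φ + star α * (star ψ₀ ⬝ᵥ Q *ᵥ χ) := by rw [e3]
    rw [hsplit]
    have t1 : ‖star χ ⬝ᵥ Q *ᵥ φ‖ ≤ ‖Q‖ * eucNorm χ := by
      calc ‖star χ ⬝ᵥ Q *ᵥ φ‖ ≤ eucNorm χ * eucNorm (Q *ᵥ φ) := norm_star_dotProduct_le _ _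
        _ ≤ eucNorm χ * (‖Q‖ * eucNorm φ) :=
            mul_le_mul_of_nonneg_left (eucNorm_mulVec_le Q φ) (eucNorm_nonneg _)
        _ = ‖Q‖ * eucNorm χ := by rw [hφ1, mul_one, mul_comm]
    have t2 : ‖star α * (star ψ₀ ⬝ᵥ Q *ᵥ χ)‖ ≤ ‖Q‖ * eucNorm χ := by
      have hαle : ‖α‖ ≤ 1 := by
        have := eucNorm_nonneg χ
        nlinarith [hχsq, norm_nonneg α, sq_nonneg (eucNorm χ)]
      calc ‖star α * (star ψ₀ ⬝ᵥ Q *ᵥ χ)‖ = ‖α‖ * ‖star ψ₀ ⬝ᵥ Q *ᵥ χ‖ := by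
            rw [norm_mul, norm_star]
        _ ≤ 1 * (eucNorm ψ₀ * eucNorm (Q *ᵥ χ)) :=
            mul_le_mul hαle (norm_star_dotProduct_le _ _) (norm_nonneg _) zero_le_one
        _ ≤ ‖Q‖ * eucNorm χ := by
            rw [one_mul, hψ1, one_mul]; exact eucNorm_mulVec_le Q χ
    calc ‖star χ ⬝ᵥ Q *ᵥ φ + star α * (star ψ₀ ⬝ᵥ Q *ᵥ χ)‖
        ≤ ‖star χ ⬝ᵥ Q *ᵥ φ‖ + ‖star α * (star ψ₀ ⬝ᵥ Q *ᵥ χ)‖ := norm_add_le _ _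
      _ ≤ 2 * ‖Q‖ * eucNorm χ := by linarith
  have hH := hgap φ hφ
  rw [← hχsq] at hH
  have hform : (star φ ⬝ᵥ (H - (h : ℂ) • Q) *ᵥ φ).re =
      (star φ ⬝ᵥ H *ᵥ φ).re - h * (star φ ⬝ᵥ Q *ᵥ φ).re := by
    rw [sub_mulVec, dotProduct_sub, smul_mulVec, dotProduct_smul, Complex.sub_re, smul_eq_mul,
      Complex.re_ofReal_mul]
  rw [hform]
  have hre : |(star φ ⬝ᵥ Q *ᵥ φ).re| ≤ 2 * ‖Q‖ * eucNorm χ :=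
    (Complex.abs_re_le_norm _).trans hQφ
  have hprod : |h * (star φ ⬝ᵥ Q *ᵥ φ).re| ≤ |h| * (2 * ‖Q‖ * eucNorm χ) := by
    rw [abs_mul]; exact mul_le_mul_of_nonneg_left hre (abs_nonneg h)
  have hsq : -(h ^ 2 * ‖Q‖ ^ 2 / γ) ≤ γ * eucNorm χ ^ 2 - 2 * |h| * ‖Q‖ * eucNorm χ := by
    set b : ℝ := |h| * ‖Q‖ with hb
    set x : ℝ := eucNorm χ with hxdef
    have hb2 : b ^ 2 = h ^ 2 * ‖Q‖ ^ 2 := by rw [hb, mul_pow, sq_abs]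
    have h4 : γ * (γ * x ^ 2 - 2 * b * x + b ^ 2 / γ) = (γ * x - b) ^ 2 := by
      field_simp
      ring
    have h5 : 0 ≤ γ * x ^ 2 - 2 * b * x + b ^ 2 / γ := by
      have : 0 ≤ γ * (γ * x ^ 2 - 2 * b * x + b ^ 2 / γ) := by rw [h4]; exact sq_nonneg _
      exact (mul_nonneg_iff_of_pos_left hγ).mp this
    rw [← hb2]
    have hbx : 2 * |h| * ‖Q‖ * x = 2 * b * x := by rw [hb]; ring
    rw [hbx]
    linarith
  linarith [le_abs_self (h * (star φ ⬝ᵥ Q *ᵥ φ).re), hprod]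

/-- Hence `E₀(H - hQ) ≥ E₀ - h²‖Q‖²/γ`. [cite: Tasaki2020, §2.1] -/
theorem groundEnergy_source_ge_of_gap {H Q : Matrix m m ℂ} (hH : H.IsHermitian) (hQ : Q.IsHermitian)
    [Nonempty m] {ψ₀ : m → ℂ} (hψ₀ : star ψ₀ ⬝ᵥ ψ₀ = 1) {E₀ γ : ℝ} (hγ : 0 < γ)
    (hgap : ∀ φ : m → ℂ, star φ ⬝ᵥ φ = 1 →
      E₀ + γ * (1 - ‖star ψ₀ ⬝ᵥ φ‖ ^ 2) ≤ (star φ ⬝ᵥ H *ᵥ φ).re)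
    (h1 : star ψ₀ ⬝ᵥ Q *ᵥ ψ₀ = 0) (h : ℝ) :
    E₀ - h ^ 2 * ‖Q‖ ^ 2 / γ ≤ (H - (h : ℂ) • Q).groundEnergy :=
  le_groundEnergy_of_forall_rayleigh (isHermitian_sub_smul hH hQ h)
    (rayleigh_source_ge_of_gap hψ₀ hγ hgap h1 h)

/-- **Gapped clusters have a `β`-uniformly bounded response**: with `E₀ = E₀(H)`, for `β ≥ 0` and all
real `h`, `log Z_β(H - hQ) - log Z_β(H) ≤ βh²‖Q‖²/γ + log dim` (entropy sandwich on both sides).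
No `log β`: a fixed gapped torus can never carry the crux's `c h² log(1/(|h|+1/β))` as `β → ∞`, so
`L₀(U,β,μ) → ∞` with `β` is forced wherever the finite cluster is non-resonant. [cite: Tasaki2020, §2.1] -/
theorem log_partitionFn_source_sub_le_of_gap {H Q : Matrix m m ℂ} (hH : H.IsHermitian)
    (hQ : Q.IsHermitian) [Nonempty m] {ψ₀ : m → ℂ} (hψ₀ : star ψ₀ ⬝ᵥ ψ₀ = 1) {γ : ℝ} (hγ : 0 < γ)
    (hgap : ∀ φ : m → ℂ, star φ ⬝ᵥ φ = 1 →
      H.groundEnergy + γ * (1 - ‖star ψ₀ ⬝ᵥ φ‖ ^ 2) ≤ (star φ ⬝ᵥ H *ᵥ φ).re)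
    (h1 : star ψ₀ ⬝ᵥ Q *ᵥ ψ₀ = 0) {β : ℝ} (hβ : 0 ≤ β) (h : ℝ) :
    Real.log (partitionFn β (H - (h : ℂ) • Q)).re - Real.log (partitionFn β H).re ≤
      β * (h ^ 2 * ‖Q‖ ^ 2 / γ) + Real.log (Fintype.card m) := by
  have hHh := isHermitian_sub_smul hH hQ h
  have hE := groundEnergy_source_ge_of_gap hH hQ hψ₀ hγ hgap h1 h
  have hD : (0 : ℝ) < Fintype.card m := by exact_mod_cast Fintype.card_pos
  have hup := partitionFn_le_card_mul_exp hHh hβ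
  have hZh : 0 < (partitionFn β (H - (h : ℂ) • Q)).re := partitionFn_re_pos hHh β
  have hup' := Real.log_le_log hZh hup
  rw [Real.log_mul hD.ne' (Real.exp_pos _).ne', Real.log_exp] at hup'
  have hlow := exp_neg_mul_groundEnergy_le_partitionFn hH β
  have hlow' := Real.log_le_log (Real.exp_pos _) hlow
  rw [Real.log_exp] at hlow'
  have hmono : -(β * (H - (h : ℂ) • Q).groundEnergy) ≤ -(β * (H.groundEnergy - h ^ 2 * ‖Q‖ ^ 2 / γ)) := by
    have := mul_le_mul_of_nonneg_left hE hβ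
    linarith
  linarith

end Gapped

end Summit.HubbardSuperconductivity.HubbardSuperconductivity.Theorems.TwSourcedCondensation.Negative
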